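import Mathlib.Analysis.SpecialFunctions.Pow.Real
import HarnessLib

/-!
# rh-explicit (venture WeilGRH): «(5/·) HAS THE SECOND-HIGHEST LOWEST ZERO» — elementary glue: three arcs of the upper unit semicircle cut into
  thirds (weil-3 gen19)

Cell `rh-explicit`, WEIL TRACK (structure seat weil-3, gen19).  Pure real-arithmetic facts, no `L`-functions.  The 40-box cover
`RunnerUpCircleUpper/Lower` of the unit circle carries the even arc certificates of the runner-up rung at `q₀ = 11` — except on the three upper
arcs `x ∈ [0.55, 0.68]`, `[0.68, 0.8]`, `[0.8, 0.92]`, where the kernel REJECTS the full-box certificates (emulated margins 1.013 / 1.012 / 1.006;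
the accepted neighbours have ≥ 1.019).  These lemmas cut each of the three arcs into three boxes with tight `y`-bounds, for the nine sub-box
certificates of `RunnerUpArcsEvenP11–13`.  RH/GRH-free; no definitions; standard axioms.
-/

set_option autoImplicit false

namespace Summit.Ventures.WeilGRH.Christoffel

/-- ★ The arc `x ∈ [0.55, 0.68]`, `y ≥ 0` of the unit circle is covered by 3 closed boxes with `x`-splits `[0.55, 0.594, 0.637, 0.68]` and tight `y`-bounds (outward to `10⁻⁴`). -/
theorem unit_circle_subcover_15 {x y : ℝ} (h : x ^ 2 + y ^ 2 = 1) (hy : 0 ≤ y) (hx0 : (0.55 : ℝ) ≤ x) (hx1 : x ≤ (0.68 : ℝ)) :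
    ((0.55 : ℝ) ≤ x ∧ x ≤ (0.594 : ℝ) ∧ (0.8044 : ℝ) ≤ y ∧ y ≤ (0.8352 : ℝ)) ∨
    ((0.594 : ℝ) ≤ x ∧ x ≤ (0.637 : ℝ) ∧ (0.7708 : ℝ) ≤ y ∧ y ≤ (0.8045 : ℝ)) ∨
    ((0.637 : ℝ) ≤ x ∧ x ≤ (0.68 : ℝ) ∧ (0.7332 : ℝ) ≤ y ∧ y ≤ (0.7709 : ℝ)) := by
  by_cases hc0 : x ≤ (0.594 : ℝ)
  · left
    have hxhi : x ^ 2 ≤ (0.352836 : ℝ) := by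
      have := pow_le_pow_left₀ (by norm_num : (0:ℝ) ≤ (0.55 : ℝ)) hx0 2
      have h2 := pow_le_pow_left₀ (by linarith : (0:ℝ) ≤ x) hc0 2; norm_num at h2 ⊢; linarith
    have hxlo : (0.3025 : ℝ) ≤ x ^ 2 := by
      have := pow_le_pow_left₀ (by norm_num : (0:ℝ) ≤ (0.55 : ℝ)) hx0 2; norm_num at this ⊢; linarith
    have hyhi : y ≤ (0.8352 : ℝ) := (pow_le_pow_iff_left₀ hy (by norm_num) two_ne_zero).1 (by norm_num; linarith)
    have hylo : (0.8044 : ℝ) ≤ y := (pow_le_pow_iff_left₀ (by norm_num) hy two_ne_zero).1 (by norm_num; linarith)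
    exact ⟨hx0, hc0, hylo, hyhi⟩
  push Not at hc0
  by_cases hc1 : x ≤ (0.637 : ℝ)
  · iterate 1 right
    left
    have hxhi : x ^ 2 ≤ (0.405769 : ℝ) := by
      have := pow_le_pow_left₀ (by norm_num : (0:ℝ) ≤ (0.594 : ℝ)) (le_of_lt hc0) 2
      have h2 := pow_le_pow_left₀ (by linarith : (0:ℝ) ≤ x) hc1 2; norm_num at h2 ⊢; linarith
    have hxlo : (0.352836 : ℝ) ≤ x ^ 2 := by
      have := pow_le_pow_left₀ (by norm_num : (0:ℝ) ≤ (0.594 : ℝ)) (le_of_lt hc0) 2; norm_num at this ⊢; linarith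
    have hyhi : y ≤ (0.8045 : ℝ) := (pow_le_pow_iff_left₀ hy (by norm_num) two_ne_zero).1 (by norm_num; linarith)
    have hylo : (0.7708 : ℝ) ≤ y := (pow_le_pow_iff_left₀ (by norm_num) hy two_ne_zero).1 (by norm_num; linarith)
    exact ⟨by linarith, hc1, hylo, hyhi⟩
  push Not at hc1
  clear hc0
  iterate 2 right
  have hxhi : x ^ 2 ≤ (0.4624 : ℝ) := by
    have := pow_le_pow_left₀ (by norm_num : (0:ℝ) ≤ (0.637 : ℝ)) (le_of_lt hc1) 2
    have h2 := pow_le_pow_left₀ (by linarith : (0:ℝ) ≤ x) hx1 2; norm_num at h2 ⊢; linarith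
  have hxlo : (0.405769 : ℝ) ≤ x ^ 2 := by
    have := pow_le_pow_left₀ (by norm_num : (0:ℝ) ≤ (0.637 : ℝ)) (le_of_lt hc1) 2; norm_num at this ⊢; linarith
  have hyhi : y ≤ (0.7709 : ℝ) := (pow_le_pow_iff_left₀ hy (by norm_num) two_ne_zero).1 (by norm_num; linarith)
  have hylo : (0.7332 : ℝ) ≤ y := (pow_le_pow_iff_left₀ (by norm_num) hy two_ne_zero).1 (by norm_num; linarith)
  exact ⟨by linarith, hx1, hylo, hyhi⟩

/-- ★ The arc `x ∈ [0.68, 0.8]`, `y ≥ 0` of the unit circle is covered by 3 closed boxes with `x`-splits `[0.68, 0.72, 0.76, 0.8]` and tight `y`-bounds (outward to `10⁻⁴`). -/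
theorem unit_circle_subcover_16 {x y : ℝ} (h : x ^ 2 + y ^ 2 = 1) (hy : 0 ≤ y) (hx0 : (0.68 : ℝ) ≤ x) (hx1 : x ≤ (0.8 : ℝ)) :
    ((0.68 : ℝ) ≤ x ∧ x ≤ (0.72 : ℝ) ∧ (0.6939 : ℝ) ≤ y ∧ y ≤ (0.7333 : ℝ)) ∨
    ((0.72 : ℝ) ≤ x ∧ x ≤ (0.76 : ℝ) ∧ (0.6499 : ℝ) ≤ y ∧ y ≤ (0.694 : ℝ)) ∨
    ((0.76 : ℝ) ≤ x ∧ x ≤ (0.8 : ℝ) ∧ (0.5999 : ℝ) ≤ y ∧ y ≤ (0.65 : ℝ)) := by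
  by_cases hc0 : x ≤ (0.72 : ℝ)
  · left
    have hxhi : x ^ 2 ≤ (0.5184 : ℝ) := by
      have := pow_le_pow_left₀ (by norm_num : (0:ℝ) ≤ (0.68 : ℝ)) hx0 2
      have h2 := pow_le_pow_left₀ (by linarith : (0:ℝ) ≤ x) hc0 2; norm_num at h2 ⊢; linarith
    have hxlo : (0.4624 : ℝ) ≤ x ^ 2 := by
      have := pow_le_pow_left₀ (by norm_num : (0:ℝ) ≤ (0.68 : ℝ)) hx0 2; norm_num at this ⊢; linarith
    have hyhi : y ≤ (0.7333 : ℝ) := (pow_le_pow_iff_left₀ hy (by norm_num) two_ne_zero).1 (by norm_num; linarith)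
    have hylo : (0.6939 : ℝ) ≤ y := (pow_le_pow_iff_left₀ (by norm_num) hy two_ne_zero).1 (by norm_num; linarith)
    exact ⟨hx0, hc0, hylo, hyhi⟩
  push Not at hc0
  by_cases hc1 : x ≤ (0.76 : ℝ)
  · iterate 1 right
    left
    have hxhi : x ^ 2 ≤ (0.5776 : ℝ) := by
      have := pow_le_pow_left₀ (by norm_num : (0:ℝ) ≤ (0.72 : ℝ)) (le_of_lt hc0) 2
      have h2 := pow_le_pow_left₀ (by linarith : (0:ℝ) ≤ x) hc1 2; norm_num at h2 ⊢; linarith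
    have hxlo : (0.5184 : ℝ) ≤ x ^ 2 := by
      have := pow_le_pow_left₀ (by norm_num : (0:ℝ) ≤ (0.72 : ℝ)) (le_of_lt hc0) 2; norm_num at this ⊢; linarith
    have hyhi : y ≤ (0.694 : ℝ) := (pow_le_pow_iff_left₀ hy (by norm_num) two_ne_zero).1 (by norm_num; linarith)
    have hylo : (0.6499 : ℝ) ≤ y := (pow_le_pow_iff_left₀ (by norm_num) hy two_ne_zero).1 (by norm_num; linarith)
    exact ⟨by linarith, hc1, hylo, hyhi⟩
  push Not at hc1
  clear hc0
  iterate 2 right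
  have hxhi : x ^ 2 ≤ (0.64 : ℝ) := by
    have := pow_le_pow_left₀ (by norm_num : (0:ℝ) ≤ (0.76 : ℝ)) (le_of_lt hc1) 2
    have h2 := pow_le_pow_left₀ (by linarith : (0:ℝ) ≤ x) hx1 2; norm_num at h2 ⊢; linarith
  have hxlo : (0.5776 : ℝ) ≤ x ^ 2 := by
    have := pow_le_pow_left₀ (by norm_num : (0:ℝ) ≤ (0.76 : ℝ)) (le_of_lt hc1) 2; norm_num at this ⊢; linarith
  have hyhi : y ≤ (0.65 : ℝ) := (pow_le_pow_iff_left₀ hy (by norm_num) two_ne_zero).1 (by norm_num; linarith)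
  have hylo : (0.5999 : ℝ) ≤ y := (pow_le_pow_iff_left₀ (by norm_num) hy two_ne_zero).1 (by norm_num; linarith)
  exact ⟨by linarith, hx1, hylo, hyhi⟩

/-- ★ The arc `x ∈ [0.8, 0.92]`, `y ≥ 0` of the unit circle is covered by 3 closed boxes with `x`-splits `[0.8, 0.84, 0.88, 0.92]` and tight `y`-bounds (outward to `10⁻⁴`). -/
theorem unit_circle_subcover_17 {x y : ℝ} (h : x ^ 2 + y ^ 2 = 1) (hy : 0 ≤ y) (hx0 : (0.8 : ℝ) ≤ x) (hx1 : x ≤ (0.92 : ℝ)) :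
    ((0.8 : ℝ) ≤ x ∧ x ≤ (0.84 : ℝ) ∧ (0.5425 : ℝ) ≤ y ∧ y ≤ (0.6 : ℝ)) ∨
    ((0.84 : ℝ) ≤ x ∧ x ≤ (0.88 : ℝ) ∧ (0.4749 : ℝ) ≤ y ∧ y ≤ (0.5426 : ℝ)) ∨
    ((0.88 : ℝ) ≤ x ∧ x ≤ (0.92 : ℝ) ∧ (0.3919 : ℝ) ≤ y ∧ y ≤ (0.475 : ℝ)) := by
  by_cases hc0 : x ≤ (0.84 : ℝ)
  · left
    have hxhi : x ^ 2 ≤ (0.7056 : ℝ) := by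
      have := pow_le_pow_left₀ (by norm_num : (0:ℝ) ≤ (0.8 : ℝ)) hx0 2
      have h2 := pow_le_pow_left₀ (by linarith : (0:ℝ) ≤ x) hc0 2; norm_num at h2 ⊢; linarith
    have hxlo : (0.64 : ℝ) ≤ x ^ 2 := by
      have := pow_le_pow_left₀ (by norm_num : (0:ℝ) ≤ (0.8 : ℝ)) hx0 2; norm_num at this ⊢; linarith
    have hyhi : y ≤ (0.6 : ℝ) := (pow_le_pow_iff_left₀ hy (by norm_num) two_ne_zero).1 (by norm_num; linarith)
    have hylo : (0.5425 : ℝ) ≤ y := (pow_le_pow_iff_left₀ (by norm_num) hy two_ne_zero).1 (by norm_num; linarith)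
    exact ⟨hx0, hc0, hylo, hyhi⟩
  push Not at hc0
  by_cases hc1 : x ≤ (0.88 : ℝ)
  · iterate 1 right
    left
    have hxhi : x ^ 2 ≤ (0.7744 : ℝ) := by
      have := pow_le_pow_left₀ (by norm_num : (0:ℝ) ≤ (0.84 : ℝ)) (le_of_lt hc0) 2
      have h2 := pow_le_pow_left₀ (by linarith : (0:ℝ) ≤ x) hc1 2; norm_num at h2 ⊢; linarith
    have hxlo : (0.7056 : ℝ) ≤ x ^ 2 := by
      have := pow_le_pow_left₀ (by norm_num : (0:ℝ) ≤ (0.84 : ℝ)) (le_of_lt hc0) 2; norm_num at this ⊢; linarith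
    have hyhi : y ≤ (0.5426 : ℝ) := (pow_le_pow_iff_left₀ hy (by norm_num) two_ne_zero).1 (by norm_num; linarith)
    have hylo : (0.4749 : ℝ) ≤ y := (pow_le_pow_iff_left₀ (by norm_num) hy two_ne_zero).1 (by norm_num; linarith)
    exact ⟨by linarith, hc1, hylo, hyhi⟩
  push Not at hc1
  clear hc0
  iterate 2 right
  have hxhi : x ^ 2 ≤ (0.8464 : ℝ) := by
    have := pow_le_pow_left₀ (by norm_num : (0:ℝ) ≤ (0.88 : ℝ)) (le_of_lt hc1) 2
    have h2 := pow_le_pow_left₀ (by linarith : (0:ℝ) ≤ x) hx1 2; norm_num at h2 ⊢; linarith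
  have hxlo : (0.7744 : ℝ) ≤ x ^ 2 := by
    have := pow_le_pow_left₀ (by norm_num : (0:ℝ) ≤ (0.88 : ℝ)) (le_of_lt hc1) 2; norm_num at this ⊢; linarith
  have hyhi : y ≤ (0.475 : ℝ) := (pow_le_pow_iff_left₀ hy (by norm_num) two_ne_zero).1 (by norm_num; linarith)
  have hylo : (0.3919 : ℝ) ≤ y := (pow_le_pow_iff_left₀ (by norm_num) hy two_ne_zero).1 (by norm_num; linarith)
  exact ⟨by linarith, hx1, hylo, hyhi⟩

end Summit.Ventures.WeilGRH.Christoffel
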